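import Literature.MathematicalPhysics.QuantumLattice.HubbardTTPrimeGrandCanonicalEquilibriumStateDictionary
import Literature.MathematicalPhysics.QuantumLattice.PeriodicPressureSuperlatticeIndependence
import Literature.MathematicalPhysics.QuantumLattice.SuperlatticeCellEnergyFamilies
import Literature.MathematicalPhysics.QuantumLattice.FermionGibbsVariationalPrinciple
import HarnessLib

/-!
# The chemical-potential axis for SUPERLATTICE-PERIODIC phases (stripes, Néel / density-wave states): the grand-canonical
# exclusion laws, the certified `Δμ` gaps and the state-level ensemble dictionary transfer VERBATIM from translation-invariant to
# `q`-periodic grand-canonical ground / equilibrium states, with «density» read as «cell filling» (model-free; `t–t'` editions)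

Topic `Literature/MathematicalPhysics/QuantumLattice` (family `hubbard`; cell `pub/hubbard-downfold`, MO-S1 ↔ S2 seam «box ↦ one word», filling direction
= the Legendre pair `μ ↔ n`; written 2026-08-28 by hubbard-downfold-unc-2 g23). The `μ`-axis laws of `TIDensityPhaseCoexistenceGrandCanonical` (g22:
«at ONE `μ` no grand-canonical ground / equilibrium state of density `≤ n₁` coexists with one of density `≥ n₂`», certified gap
`a·b·(n₂−n₁)·(μ₂ − μ₁) ≥ margin`) and the state-level dictionary of `HubbardTTPrimeGrandCanonicalEquilibriumStateDictionary` (g23) speak about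
TRANSLATION-INVARIANT states (`IsMeanEnergyMinimiser`, `IsVarEquilibrium`). At `x = 1/8` the competing order of record is a STRIPE — a
superlattice-periodic state. THE POINT (one line of state algebra, as in hubbard-box-p1's `HubbardTTPrimeThermalPhaseCoexistenceCanonicalPeriodic`):
for a translation-covariant interaction `Γ`, the CELL AVERAGE `ω̄ = ω.cellAverage q` of a `q`-periodic grand-canonical equilibrium state
(`IsPerVarEquilibrium β q Γ`, a `q`-periodic maximiser of `s̄ − βē_q`) is a translation-invariant grand-canonical equilibrium state at the SAME `(β, μ)`
(`IsPerVarEquilibrium.cellAverage_isVarEquilibrium`, tree) whose density is the cell filling `ρ̄(ω) = ω.cellFilling q`; likewise (§1, proved here) the cell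
average of a `q`-periodic state minimising the cell energy `ē_q(Γ)` among `q`-periodic states is a translation-invariant mean-energy minimiser of `Γ`.
Hence every two-state `μ`-sentence transfers, each state averaged over ITS OWN period cell (no common period needed):

* §1 `T = 0`, model-free (`Γ` translation covariant, any `Ψ` with `e_Γ = e_Ψ − μρ`): `IsPeriodic.isMeanEnergyMinimiser_cellAverage`; the generic transfer
  `of_periodicGroundStates₂`; **`margin_le_mul_sub_chemPot_of_periodicGroundStates`** (gap between `μ₁` carrying a `q₁`-periodic ground state of cell
  filling `≤ n₁` and `μ₂` carrying a `q₂`-periodic one of cell filling `≥ n₂`) and the one-`μ` exclusion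
  **`IsPeriodic.not_periodicGroundState_of_cellFilling_le_of_le_cellFilling`**.
* §2 `T > 0`, model-free (`d ≥ 1`): the generic transfer `of_isPerVarEquilibrium₂`; **`pressureMargin_le_mul_sub_chemPot_of_isPerVarEquilibrium`**;
  **`IsPerVarEquilibrium.not_isPerVarEquilibrium_of_cellFilling_le_of_le_cellFilling`** — at ONE `(β, μ)` no `q₁`-periodic equilibrium of cell filling
  `≤ n₁` coexists with a `q₂`-periodic one of cell filling `≥ n₂` (stripe / uniform, stripe / stripe, Néel / uniform …).
* §3 the `t–t'` hot-anchor editions (`β > 0`, `U ≥ 0`): `margin_le_mul_sub_chemPot_of_perEquilibria_hotAnchors_ttPrime`,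
  `IsPerVarEquilibrium.not_isPerVarEquilibrium_of_le_of_le_hotAnchors_threshold_ttPrime`, `mul_gap_le_mul_sub_chemPot_of_perEquilibria_hotAnchors_threshold_ttPrime`
  — hypotheses IDENTICAL to the translation-invariant forms, so every typed cell / registry sentence has a periodic edition by one `exact`.
* §4 THE PERIODIC STATE-LEVEL DICTIONARY (`t–t'`, `T > 0`): **`isPerVarEquilibrium_iff_sub_mul_eq_pressureTT'_and_supporting`** — a `q`-periodic `ω`
  with `0 < ρ̄(ω) < 2` is a `q`-periodic grand-canonical equilibrium state of `H − μN` IFF `s̄(ω) − β ē_q(Φ)(ω) = p(β; ρ̄(ω))` AND `μ` supports `p(β;·)`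
  at `ρ̄(ω)`; corollaries `IsPerVarEquilibrium.isPerVarEquilibrium_iff_supporting` (the `μ'` carrying a given stripe equilibrium state are exactly the
  supporting set — the compact interval `M_β(ρ̄)` of the dictionary file) and the `gcInteractionTT'` instance.

HONEST SCOPE: statements about superlattice-periodic variational equilibria / periodic cell-energy minimisers of translation-covariant interactions
(any period lattice `q`, each state its own); exclusion of their SIMULTANEOUS occurrence as grand-canonical equilibria at one `μ` (resp. a floor on the
distance of their chemical potentials) — silent on the internal structure of a single periodic phase, on which phase is realised, on stripes as ground
states, on `T_c`; no number, no named fact, no definition. Everything is PROVED, 0 sorry.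

## Mathlib / tree search
REUSED: `IsPerVarEquilibrium`, `IsPerVarEquilibrium.cellAverage_isVarEquilibrium`, `…entropyDensitySup_cellAverage_eq`, `IsVarEquilibrium.isPerVarEquilibrium`,
`FermionInteraction.perVarPressure_eq_varPressure` (`PeriodicPressureSuperlatticeIndependence`, `PeriodicVariationalPressure`); `cellAverage`,
`IsPeriodic.isTranslationInvariant_cellAverage`, `IsTranslationInvariant.isPeriodic` (`PeriodicStatesCellAverage`); `cellMeanEnergy`,
`cellMeanEnergy_eq_meanEnergy_cellAverage`, `IsTranslationInvariant.cellMeanEnergy_eq` (`PeriodicInteractionsCellEnergy`); `cellFilling_eq_density_cellAverage`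
(`SuperlatticeCellEnergyFamilies`); `gcInteractionTT'_isTranslationInvariant` (`FermionGibbsVariationalPrinciple`); the translation-invariant laws
`margin_le_mul_sub_chemPot_of_isMeanEnergyMinimiser`, `pressureMargin_le_mul_sub_chemPot_of_isVarEquilibrium` (`TIDensityPhaseCoexistenceGrandCanonical`),
`margin_le_mul_sub_chemPot_of_equilibria_hotAnchors_ttPrime`, `mul_gap_le_mul_sub_chemPot_of_equilibria_hotAnchors_threshold_ttPrime`
(`HubbardTTPrimePhaseCoexistenceExclusionGrandCanonical`), `isVarEquilibrium_iff_sub_mul_eq_pressureTT'_and_supporting`, `varPressure_eq_gcPressureTT'_of_muShift`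
(`HubbardTTPrimeGrandCanonicalEquilibriumStateDictionary`). `lean search 'IsPerVarEquilibrium.*chemPot|cellFilling.*IsVarEquilibrium.*not|PerVarEquilibrium.*pressureTT'`
(2026-08-28): nothing — the tree's periodic transfers are the CANONICAL mixture ones (`HubbardTTPrimeThermalPhaseCoexistenceCanonicalPeriodic`,
`HubbardTTPrimePhaseCoexistenceExclusionPeriodic`) and the Griffiths windows of `PeriodicEquilibriumStatesPerturbationRows`.

## References
* R. B. Israel, *Convexity in the Theory of Lattice Gases* (1979), Thm. I.2.4, Thm. II.3.2 (periodic states and pressures). [cite: Israel1979, Thm. I.2.4]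
* O. Bratteli, D. W. Robinson, *OAQSM 1* (1987), §4.3.1 (averaging over a group action). [cite: BratteliRobinsonI1987, §4.3.1]
* H. Araki, H. Moriya, Rev. Math. Phys. 15 (2003) 93, Thm. 12.11. [cite: ArakiMoriya2003, Theorem 12.11]
* J. M. Tranquada et al., Nature 375 (1995) 561 (stripe order at `x = 1/8`). [cite: TranquadaEtAl1995, Fig. 1]
* D. Ruelle, *Statistical Mechanics: Rigorous Results* (1969), §3.4. [cite: Ruelle1969, §3.4]
-/

noncomputable section

open scoped ComplexOrder BigOperators

namespace Literature.MathematicalPhysics.QuantumLattice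

open Matrix HubbardWave0 Literature.Probability.LatticeModels ThermodynamicLimit InfVolFermionState FermionInteraction Set

namespace InfVolFermionState

/-! ## §1 `T = 0`, model-free: periodic grand-canonical ground states -/

section GroundStates

variable {d : ℕ} {q q₁ q₂ : Fin d → ℕ} (Ψ : FermionInteraction d) (R : ℝ) {Γ Γ₁ Γ₂ : FermionInteraction d} {R' R₁ R₂ μ μ₁ μ₂ : ℝ}
  {ω ω₁ ω₂ : InfVolFermionState d}

/-- **The cell average of a periodic grand-canonical ground state is a translation-invariant one.** If `Γ` is translation covariant and the
`q`-periodic `ω` minimises the cell energy `ē_q(Γ)` among `q`-periodic states, then `ω̄ = ω.cellAverage q` minimises `e_Γ` among translation-invariant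
states (`e_Γ(ω̄) = ē_q(Γ)(ω)`, and translation-invariant states are `q`-periodic with `ē_q = e`). [cite: BratteliRobinsonI1987, §4.3.1] [cite: Israel1979, Thm. I.2.4] -/
theorem IsPeriodic.isMeanEnergyMinimiser_cellAverage (hω : ω.IsPeriodic q) (hT : Γ.IsTranslationInvariant)
    (hmin : ∀ σ : InfVolFermionState d, σ.IsPeriodic q → cellMeanEnergy q Γ ω R' ≤ cellMeanEnergy q Γ σ R') :
    (ω.cellAverage q).IsMeanEnergyMinimiser Γ R' := by
  refine ⟨hω.isTranslationInvariant_cellAverage, fun σ hσ => ?_⟩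
  rw [← cellMeanEnergy_eq_meanEnergy_cellAverage hT, ← hσ.cellMeanEnergy_eq (q := q) hT]
  exact hmin σ (hσ.isPeriodic q)

/-- **Generic transfer (`T = 0`).** Any conclusion `C` that follows from «`σ₁` a translation-invariant ground state of `Γ₁` with `ρ(σ₁) ≤ n₁` and `σ₂`
one of `Γ₂` with `ρ(σ₂) ≥ n₂`» holds for a `q₁`-periodic ground state of `Γ₁` with cell filling `≤ n₁` and a `q₂`-periodic one of `Γ₂` with cell filling
`≥ n₂` (`Γᵢ` translation covariant). [cite: BratteliRobinsonI1987, §4.3.1] -/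
theorem of_periodicGroundStates₂ {C : Prop} {n₁ n₂ : ℝ}
    (H : ∀ {σ₁ σ₂ : InfVolFermionState d}, σ₁.IsMeanEnergyMinimiser Γ₁ R₁ → σ₂.IsMeanEnergyMinimiser Γ₂ R₂ →
      σ₁.density ≤ n₁ → n₂ ≤ σ₂.density → C)
    (hT₁ : Γ₁.IsTranslationInvariant) (hT₂ : Γ₂.IsTranslationInvariant) (h₁ : ω₁.IsPeriodic q₁)
    (hmin₁ : ∀ σ : InfVolFermionState d, σ.IsPeriodic q₁ → cellMeanEnergy q₁ Γ₁ ω₁ R₁ ≤ cellMeanEnergy q₁ Γ₁ σ R₁)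
    (h₂ : ω₂.IsPeriodic q₂)
    (hmin₂ : ∀ σ : InfVolFermionState d, σ.IsPeriodic q₂ → cellMeanEnergy q₂ Γ₂ ω₂ R₂ ≤ cellMeanEnergy q₂ Γ₂ σ R₂)
    (hρ₁ : ω₁.cellFilling q₁ ≤ n₁) (hρ₂ : n₂ ≤ ω₂.cellFilling q₂) : C := by
  rw [cellFilling_eq_density_cellAverage] at hρ₁ hρ₂
  exact H (h₁.isMeanEnergyMinimiser_cellAverage hT₁ hmin₁) (h₂.isMeanEnergyMinimiser_cellAverage hT₂ hmin₂) hρ₁ hρ₂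

/-- **CERTIFIED CHEMICAL-POTENTIAL GAP BETWEEN PERIODIC PHASES (`T = 0`, model-free).** `Γ₁, Γ₂` translation covariant with `e_{Γᵢ} = e_Ψ − μᵢρ`;
`ω₁` a `q₁`-periodic ground state of `Γ₁` (cell-energy minimiser among `q₁`-periodic states) with cell filling `≤ n₁`, `ω₂` a `q₂`-periodic one of `Γ₂`
with cell filling `≥ n₂` (`n₁ ≤ n₂`); a cap `e_{an₁+bn₂}(Ψ) ≤ c` and floors `fᵢ ≤ e_{nᵢ}(Ψ)`. Then `a·b·(n₂ − n₁)·(μ₂ − μ₁) ≥ af₁ + bf₂ − c`.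
[cite: Israel1979, Thm. I.2.4] [cite: BratteliRobinsonI1987, §4.3.1] -/
theorem margin_le_mul_sub_chemPot_of_periodicGroundStates (hT₁ : Γ₁.IsTranslationInvariant) (hT₂ : Γ₂.IsTranslationInvariant)
    (h₁ : ω₁.IsPeriodic q₁)
    (hmin₁ : ∀ σ : InfVolFermionState d, σ.IsPeriodic q₁ → cellMeanEnergy q₁ Γ₁ ω₁ R₁ ≤ cellMeanEnergy q₁ Γ₁ σ R₁)
    (hΓ₁ : ∀ σ : InfVolFermionState d, σ.meanEnergy Γ₁ R₁ = σ.meanEnergy Ψ R - μ₁ * σ.density)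
    (h₂ : ω₂.IsPeriodic q₂)
    (hmin₂ : ∀ σ : InfVolFermionState d, σ.IsPeriodic q₂ → cellMeanEnergy q₂ Γ₂ ω₂ R₂ ≤ cellMeanEnergy q₂ Γ₂ σ R₂)
    (hΓ₂ : ∀ σ : InfVolFermionState d, σ.meanEnergy Γ₂ R₂ = σ.meanEnergy Ψ R - μ₂ * σ.density)
    {n₁ n₂ : ℝ} (hn₁ : ω₁.cellFilling q₁ ≤ n₁) (hn : n₁ ≤ n₂) (hn₂ : n₂ ≤ ω₂.cellFilling q₂)
    {a b : ℝ} (ha : 0 ≤ a) (hb : 0 ≤ b) (hab : a + b = 1) {c f₁ f₂ : ℝ}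
    (hcap : Ψ.tiGroundEnergyDensityAt R (a * n₁ + b * n₂) ≤ c)
    (hf₁ : f₁ ≤ Ψ.tiGroundEnergyDensityAt R n₁) (hf₂ : f₂ ≤ Ψ.tiGroundEnergyDensityAt R n₂) :
    a * f₁ + b * f₂ - c ≤ a * b * (n₂ - n₁) * (μ₂ - μ₁) :=
  of_periodicGroundStates₂ (C := a * f₁ + b * f₂ - c ≤ a * b * (n₂ - n₁) * (μ₂ - μ₁))
    (fun k₁ k₂ hr₁ hr₂ => margin_le_mul_sub_chemPot_of_isMeanEnergyMinimiser Ψ R k₁ hΓ₁ k₂ hΓ₂ hr₁ hn hr₂ ha hb hab hcap hf₁ hf₂)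
    hT₁ hT₂ h₁ hmin₁ h₂ hmin₂ hn₁ hn₂

/-- **NO `μ` CARRIES BOTH A PERIODIC PHASE OF CELL FILLING `≤ n₁` AND ONE OF CELL FILLING `≥ n₂` (`T = 0`, model-free).** With a positive margin
`c < af₁ + bf₂`: if a `q₁`-periodic ground state of `Γ` (`e_Γ = e_Ψ − μρ`, translation covariant) has cell filling `≤ n₁`, then no `q₂`-periodic state of
cell filling `≥ n₂` minimises the cell energy of `Γ` among `q₂`-periodic states. [cite: Israel1979, Thm. I.2.4] [cite: BratteliRobinsonI1987, §4.3.1] -/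
theorem IsPeriodic.not_periodicGroundState_of_cellFilling_le_of_le_cellFilling (hT : Γ.IsTranslationInvariant) (h₁ : ω₁.IsPeriodic q₁)
    (hmin₁ : ∀ σ : InfVolFermionState d, σ.IsPeriodic q₁ → cellMeanEnergy q₁ Γ ω₁ R' ≤ cellMeanEnergy q₁ Γ σ R')
    (hΓ : ∀ σ : InfVolFermionState d, σ.meanEnergy Γ R' = σ.meanEnergy Ψ R - μ * σ.density) (h₂ : ω₂.IsPeriodic q₂)
    {n₁ n₂ : ℝ} (hn₁ : ω₁.cellFilling q₁ ≤ n₁) (hn : n₁ ≤ n₂) (hn₂ : n₂ ≤ ω₂.cellFilling q₂)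
    {a b : ℝ} (ha : 0 ≤ a) (hb : 0 ≤ b) (hab : a + b = 1) {c f₁ f₂ : ℝ}
    (hcap : Ψ.tiGroundEnergyDensityAt R (a * n₁ + b * n₂) ≤ c)
    (hf₁ : f₁ ≤ Ψ.tiGroundEnergyDensityAt R n₁) (hf₂ : f₂ ≤ Ψ.tiGroundEnergyDensityAt R n₂) (hc : c < a * f₁ + b * f₂) :
    ¬ ∀ σ : InfVolFermionState d, σ.IsPeriodic q₂ → cellMeanEnergy q₂ Γ ω₂ R' ≤ cellMeanEnergy q₂ Γ σ R' := by
  intro hmin₂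
  have h := margin_le_mul_sub_chemPot_of_periodicGroundStates Ψ R hT hT h₁ hmin₁ hΓ h₂ hmin₂ hΓ hn₁ hn hn₂ ha hb hab hcap hf₁ hf₂
  rw [sub_self, mul_zero] at h
  linarith

end GroundStates

/-! ## §2 `T > 0`, model-free: periodic grand-canonical equilibrium states (`IsPerVarEquilibrium β q Γ`) -/

section Equilibria

variable {d : ℕ} (hd : 0 < d) {q q₁ q₂ : Fin d → ℕ} (β : ℝ) (Ψ : FermionInteraction d) (R : ℝ) {Γ Γ₁ Γ₂ : FermionInteraction d}
  {R' R₁ R₂ μ μ₁ μ₂ : ℝ} {ω ω₁ ω₂ : InfVolFermionState d}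

include hd in
/-- **Generic transfer (`T > 0`).** Any conclusion `C` that follows from «`σ₁` a translation-invariant equilibrium of `Γ₁` at `β` with `ρ(σ₁) ≤ n₁` and
`σ₂` one of `Γ₂` with `ρ(σ₂) ≥ n₂`» holds for a `q₁`-periodic equilibrium of `Γ₁` with cell filling `≤ n₁` and a `q₂`-periodic one of `Γ₂` with cell
filling `≥ n₂` (`Γᵢ` translation covariant; each state is averaged over its own cell). [cite: BratteliRobinsonI1987, §4.3.1] [cite: Israel1979, Thm. I.2.4] -/
theorem of_isPerVarEquilibrium₂ {C : Prop} {n₁ n₂ : ℝ}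
    (H : ∀ {σ₁ σ₂ : InfVolFermionState d}, σ₁.IsVarEquilibrium β Γ₁ R₁ → σ₂.IsVarEquilibrium β Γ₂ R₂ →
      σ₁.density ≤ n₁ → n₂ ≤ σ₂.density → C)
    (hT₁ : Γ₁.IsTranslationInvariant) (hT₂ : Γ₂.IsTranslationInvariant) (h₁ : ω₁.IsPerVarEquilibrium β q₁ Γ₁ R₁)
    (h₂ : ω₂.IsPerVarEquilibrium β q₂ Γ₂ R₂) (hρ₁ : ω₁.cellFilling q₁ ≤ n₁) (hρ₂ : n₂ ≤ ω₂.cellFilling q₂) : C := by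
  rw [cellFilling_eq_density_cellAverage] at hρ₁ hρ₂
  exact H (h₁.cellAverage_isVarEquilibrium hd hT₁) (h₂.cellAverage_isVarEquilibrium hd hT₂) hρ₁ hρ₂

include hd in
/-- **CERTIFIED CHEMICAL-POTENTIAL GAP BETWEEN PERIODIC PHASES (`T > 0`, model-free, `d ≥ 1`).** `Γ₁, Γ₂` translation covariant with
`e_{Γᵢ} = e_Ψ − μᵢρ`; `ω₁` a `q₁`-periodic equilibrium of `Γ₁` at `β` with cell filling `≤ n₁`, `ω₂` a `q₂`-periodic equilibrium of `Γ₂` at `β` with cell filling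
`≥ n₂`; a pressure floor `W ≤ P(β,Ψ; an₁+bn₂)` and caps `P(β,Ψ;nᵢ) ≤ Qᵢ`. Then `a·b·(n₂ − n₁)·β(μ₂ − μ₁) ≥ W − aQ₁ − bQ₂`.
[cite: Israel1979, Thm. I.2.4] [cite: ArakiMoriya2003, Theorem 12.11] -/
theorem pressureMargin_le_mul_sub_chemPot_of_isPerVarEquilibrium (hT₁ : Γ₁.IsTranslationInvariant) (hT₂ : Γ₂.IsTranslationInvariant)
    (hω₁ : ω₁.IsPerVarEquilibrium β q₁ Γ₁ R₁)
    (hΓ₁ : ∀ σ : InfVolFermionState d, σ.meanEnergy Γ₁ R₁ = σ.meanEnergy Ψ R - μ₁ * σ.density)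
    (hω₂ : ω₂.IsPerVarEquilibrium β q₂ Γ₂ R₂)
    (hΓ₂ : ∀ σ : InfVolFermionState d, σ.meanEnergy Γ₂ R₂ = σ.meanEnergy Ψ R - μ₂ * σ.density)
    {n₁ n₂ : ℝ} (hn₁ : ω₁.cellFilling q₁ ≤ n₁) (hn : n₁ ≤ n₂) (hn₂ : n₂ ≤ ω₂.cellFilling q₂)
    {a b : ℝ} (ha : 0 ≤ a) (hb : 0 ≤ b) (hab : a + b = 1) {W Q₁ Q₂ : ℝ}
    (hW : W ≤ Ψ.varPressureAt β R (a * n₁ + b * n₂))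
    (hQ₁ : Ψ.varPressureAt β R n₁ ≤ Q₁) (hQ₂ : Ψ.varPressureAt β R n₂ ≤ Q₂) :
    W - a * Q₁ - b * Q₂ ≤ a * b * (n₂ - n₁) * (β * (μ₂ - μ₁)) :=
  of_isPerVarEquilibrium₂ hd β (C := W - a * Q₁ - b * Q₂ ≤ a * b * (n₂ - n₁) * (β * (μ₂ - μ₁)))
    (fun k₁ k₂ hr₁ hr₂ => pressureMargin_le_mul_sub_chemPot_of_isVarEquilibrium hd β Ψ R k₁ hΓ₁ k₂ hΓ₂ hr₁ hn hr₂ ha hb hab hW hQ₁ hQ₂)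
    hT₁ hT₂ hω₁ hω₂ hn₁ hn₂

include hd in
/-- **NO `(β, μ)` CARRIES BOTH A PERIODIC EQUILIBRIUM OF CELL FILLING `≤ n₁` AND ONE OF CELL FILLING `≥ n₂` (`T > 0`, model-free).** With
`aQ₁ + bQ₂ < W`: if a `q₁`-periodic equilibrium state of the translation-covariant `Γ` (`e_Γ = e_Ψ − μρ`) at `β` has cell filling `≤ n₁`, then NO
`q₂`-periodic equilibrium state of `Γ` at `β` has cell filling `≥ n₂` — stripe / uniform, stripe / stripe, Néel / uniform pairs all excluded.
[cite: Israel1979, Thm. I.2.4] [cite: ArakiMoriya2003, Theorem 12.11] -/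
theorem IsPerVarEquilibrium.not_isPerVarEquilibrium_of_cellFilling_le_of_le_cellFilling (hT : Γ.IsTranslationInvariant)
    (hω₁ : ω₁.IsPerVarEquilibrium β q₁ Γ R')
    (hΓ : ∀ σ : InfVolFermionState d, σ.meanEnergy Γ R' = σ.meanEnergy Ψ R - μ * σ.density)
    {n₁ n₂ : ℝ} (hn₁ : ω₁.cellFilling q₁ ≤ n₁) (hn : n₁ ≤ n₂) (hn₂ : n₂ ≤ ω₂.cellFilling q₂)
    {a b : ℝ} (ha : 0 ≤ a) (hb : 0 ≤ b) (hab : a + b = 1) {W Q₁ Q₂ : ℝ}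
    (hW : W ≤ Ψ.varPressureAt β R (a * n₁ + b * n₂))
    (hQ₁ : Ψ.varPressureAt β R n₁ ≤ Q₁) (hQ₂ : Ψ.varPressureAt β R n₂ ≤ Q₂) (hlt : a * Q₁ + b * Q₂ < W) :
    ¬ ω₂.IsPerVarEquilibrium β q₂ Γ R' := by
  intro hω₂
  have h := pressureMargin_le_mul_sub_chemPot_of_isPerVarEquilibrium hd β Ψ R hT hT hω₁ hΓ hω₂ hΓ hn₁ hn hn₂ ha hb hab hW hQ₁ hQ₂
  rw [sub_self, mul_zero, mul_zero] at h
  linarith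

include hd in
/-- Translation-invariant equilibria are the `q`-periodic equilibria of period one in every direction, so the periodic sentences CONTAIN the
translation-invariant ones: a translation-invariant equilibrium is a `q`-periodic equilibrium for every `q`, with cell filling its density.
[cite: Israel1979, Thm. I.2.4] -/
theorem IsVarEquilibrium.isPerVarEquilibrium_and_cellFilling_eq (hT : Γ.IsTranslationInvariant) (h : ω.IsVarEquilibrium β Γ R')
    (q : Fin d → ℕ) : ω.IsPerVarEquilibrium β q Γ R' ∧ ω.cellFilling q = ω.density := by
  refine ⟨h.isPerVarEquilibrium hd hT q, ?_⟩
  rw [cellFilling_eq_density_cellAverage]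
  show (ω.shiftAverage _).density = ω.density
  rw [h.1.shiftAverage_eq]

end Equilibria

/-! ## §3 The `t–t'` model at `T > 0`, hot anchors: periodic editions with IDENTICAL hypotheses -/

section TTPrime

variable (t t' : ℝ) {U : ℝ} (hU : 0 ≤ U) {β : ℝ} (hβ : 0 < β) {q q₁ q₂ : Fin 2 → ℕ} {Γ Γ₁ Γ₂ : FermionInteraction 2}
  {R' R₁ R₂ μ μ₁ μ₂ : ℝ} {ω ω₁ ω₂ : InfVolFermionState 2}
include hU hβ

/-- **Hot-anchored `Δμ` gap between PERIODIC phases (`t–t'`, `T > 0`).** Hypotheses of `margin_le_mul_sub_chemPot_of_equilibria_hotAnchors_ttPrime` with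
`q₁`- / `q₂`-periodic equilibria and cell fillings in place of translation-invariant equilibria and densities (`Γᵢ` translation covariant):
`a·b·(n₂ − n₁)·β(μ₂ − μ₁) ≥ β(af₁ + bf₂ − c) − (aπ₁ + bπ₂ + β_{h,1}af₁ + β_{h,2}bf₂)`. [cite: Israel1979, Thm. I.2.4] [cite: PoulinHastings2011, eqs. (3)–(8)] -/
theorem margin_le_mul_sub_chemPot_of_perEquilibria_hotAnchors_ttPrime (hT₁ : Γ₁.IsTranslationInvariant) (hT₂ : Γ₂.IsTranslationInvariant)
    (hω₁ : ω₁.IsPerVarEquilibrium β q₁ Γ₁ R₁)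
    (hΓ₁ : ∀ σ : InfVolFermionState 2, σ.meanEnergy Γ₁ R₁ = σ.meanEnergy (hubbardTTPrimeFermionInteraction t t' U) 1 - μ₁ * σ.density)
    (hω₂ : ω₂.IsPerVarEquilibrium β q₂ Γ₂ R₂)
    (hΓ₂ : ∀ σ : InfVolFermionState 2, σ.meanEnergy Γ₂ R₂ = σ.meanEnergy (hubbardTTPrimeFermionInteraction t t' U) 1 - μ₂ * σ.density)
    {n₁ n₂ : ℝ} (hn₁0 : 0 < n₁) (hn₂2 : n₂ < 2) (hn₁ : ω₁.cellFilling q₁ ≤ n₁) (hn : n₁ ≤ n₂) (hn₂ : n₂ ≤ ω₂.cellFilling q₂)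
    {a b : ℝ} (ha : 0 ≤ a) (hb : 0 ≤ b) (hab : a + b = 1) {c f₁ f₂ : ℝ}
    (hcap : energyDensityTT' t t' U (a * n₁ + b * n₂) ≤ c)
    (hf₁ : f₁ ≤ energyDensityTT' t t' U n₁) (hf₂ : f₂ ≤ energyDensityTT' t t' U n₂)
    {βh₁ βh₂ π₁ π₂ : ℝ} (hβh₁ : 0 ≤ βh₁) (hβh₂ : 0 ≤ βh₂) (hle₁ : βh₁ ≤ β) (hle₂ : βh₂ ≤ β)
    (hπ₁ : pressureTT' βh₁ t t' U n₁ ≤ π₁) (hπ₂ : pressureTT' βh₂ t t' U n₂ ≤ π₂) :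
    β * (a * f₁ + b * f₂ - c) - (a * π₁ + b * π₂ + βh₁ * (a * f₁) + βh₂ * (b * f₂)) ≤
      a * b * (n₂ - n₁) * (β * (μ₂ - μ₁)) :=
  of_isPerVarEquilibrium₂ two_pos β
    (C := β * (a * f₁ + b * f₂ - c) - (a * π₁ + b * π₂ + βh₁ * (a * f₁) + βh₂ * (b * f₂)) ≤ a * b * (n₂ - n₁) * (β * (μ₂ - μ₁)))
    (fun k₁ k₂ hr₁ hr₂ => margin_le_mul_sub_chemPot_of_equilibria_hotAnchors_ttPrime t t' hU hβ k₁ hΓ₁ k₂ hΓ₂ hn₁0 hn₂2 hr₁ hn hr₂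
      ha hb hab hcap hf₁ hf₂ hβh₁ hβh₂ hle₁ hle₂ hπ₁ hπ₂)
    hT₁ hT₂ hω₁ hω₂ hn₁ hn₂

/-- **No `(β, μ)` carries both PERIODIC phases, threshold form** («for every `β ≥ β₀`»; hypotheses of
`IsVarEquilibrium.not_isVarEquilibrium_of_le_of_le_hotAnchors_threshold_ttPrime`, `Γ` translation covariant): a `q₁`-periodic equilibrium of cell filling
`≤ n₁` at `(β, μ)` excludes every `q₂`-periodic equilibrium of cell filling `≥ n₂` at the same `(β, μ)`. [cite: Israel1979, Thm. I.2.4] [cite: PoulinHastings2011, eqs. (3)–(8)] -/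
theorem IsPerVarEquilibrium.not_isPerVarEquilibrium_of_le_of_le_hotAnchors_threshold_ttPrime (hT : Γ.IsTranslationInvariant)
    (hω₁ : ω₁.IsPerVarEquilibrium β q₁ Γ R')
    (hΓ : ∀ σ : InfVolFermionState 2, σ.meanEnergy Γ R' = σ.meanEnergy (hubbardTTPrimeFermionInteraction t t' U) 1 - μ * σ.density)
    {n₁ n₂ : ℝ} (hn₁0 : 0 < n₁) (hn₂2 : n₂ < 2) (hn₁ : ω₁.cellFilling q₁ ≤ n₁) (hn : n₁ ≤ n₂) (hn₂ : n₂ ≤ ω₂.cellFilling q₂)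
    {a b : ℝ} (ha : 0 ≤ a) (hb : 0 ≤ b) (hab : a + b = 1) {c f₁ f₂ : ℝ}
    (hcap : energyDensityTT' t t' U (a * n₁ + b * n₂) ≤ c)
    (hf₁ : f₁ ≤ energyDensityTT' t t' U n₁) (hf₂ : f₂ ≤ energyDensityTT' t t' U n₂)
    {βh₁ βh₂ π₁ π₂ β₀ : ℝ} (hβh₁ : 0 ≤ βh₁) (hβh₂ : 0 ≤ βh₂) (h0₁ : βh₁ ≤ β₀) (h0₂ : βh₂ ≤ β₀) (hβ₀ : β₀ ≤ β)
    (hπ₁ : pressureTT' βh₁ t t' U n₁ ≤ π₁) (hπ₂ : pressureTT' βh₂ t t' U n₂ ≤ π₂)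
    (hMnn : 0 ≤ a * f₁ + b * f₂ - c) (hM₀ : a * π₁ + b * π₂ + βh₁ * (a * f₁) + βh₂ * (b * f₂) < β₀ * (a * f₁ + b * f₂ - c)) :
    ¬ ω₂.IsPerVarEquilibrium β q₂ Γ R' := by
  intro hω₂
  exact of_isPerVarEquilibrium₂ two_pos β (C := False)
    (fun k₁ k₂ hr₁ hr₂ => k₁.not_isVarEquilibrium_of_le_of_le_hotAnchors_threshold_ttPrime t t' hU hβ hΓ hn₁0 hn₂2 hr₁ hn hr₂ ha hb hab
      hcap hf₁ hf₂ hβh₁ hβh₂ h0₁ h0₂ hβ₀ hπ₁ hπ₂ hMnn hM₀ k₂)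
    hT hT hω₁ hω₂ hn₁ hn₂

/-- **Hot-anchored gap between PERIODIC phases, threshold form** («for every `β ≥ β₀` the distance is `≥ g/(ab(n₂−n₁))`»; hypotheses of
`mul_gap_le_mul_sub_chemPot_of_equilibria_hotAnchors_threshold_ttPrime`): `β·g ≤ a·b·(n₂ − n₁)·β(μ₂ − μ₁)`. [cite: Israel1979, Thm. I.2.4] [cite: PoulinHastings2011, eqs. (3)–(8)] -/
theorem mul_gap_le_mul_sub_chemPot_of_perEquilibria_hotAnchors_threshold_ttPrime (hT₁ : Γ₁.IsTranslationInvariant)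
    (hT₂ : Γ₂.IsTranslationInvariant) (hω₁ : ω₁.IsPerVarEquilibrium β q₁ Γ₁ R₁)
    (hΓ₁ : ∀ σ : InfVolFermionState 2, σ.meanEnergy Γ₁ R₁ = σ.meanEnergy (hubbardTTPrimeFermionInteraction t t' U) 1 - μ₁ * σ.density)
    (hω₂ : ω₂.IsPerVarEquilibrium β q₂ Γ₂ R₂)
    (hΓ₂ : ∀ σ : InfVolFermionState 2, σ.meanEnergy Γ₂ R₂ = σ.meanEnergy (hubbardTTPrimeFermionInteraction t t' U) 1 - μ₂ * σ.density)
    {n₁ n₂ : ℝ} (hn₁0 : 0 < n₁) (hn₂2 : n₂ < 2) (hn₁ : ω₁.cellFilling q₁ ≤ n₁) (hn : n₁ ≤ n₂) (hn₂ : n₂ ≤ ω₂.cellFilling q₂)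
    {a b : ℝ} (ha : 0 ≤ a) (hb : 0 ≤ b) (hab : a + b = 1) {c f₁ f₂ : ℝ}
    (hcap : energyDensityTT' t t' U (a * n₁ + b * n₂) ≤ c)
    (hf₁ : f₁ ≤ energyDensityTT' t t' U n₁) (hf₂ : f₂ ≤ energyDensityTT' t t' U n₂)
    {βh₁ βh₂ π₁ π₂ β₀ g : ℝ} (hβh₁ : 0 ≤ βh₁) (hβh₂ : 0 ≤ βh₂) (h0₁ : βh₁ ≤ β₀) (h0₂ : βh₂ ≤ β₀) (hβ₀ : β₀ ≤ β)
    (hπ₁ : pressureTT' βh₁ t t' U n₁ ≤ π₁) (hπ₂ : pressureTT' βh₂ t t' U n₂ ≤ π₂) (hgM : g ≤ a * f₁ + b * f₂ - c)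
    (hN : a * π₁ + b * π₂ + βh₁ * (a * f₁) + βh₂ * (b * f₂) ≤ β₀ * (a * f₁ + b * f₂ - c - g)) :
    β * g ≤ a * b * (n₂ - n₁) * (β * (μ₂ - μ₁)) :=
  of_isPerVarEquilibrium₂ two_pos β (C := β * g ≤ a * b * (n₂ - n₁) * (β * (μ₂ - μ₁)))
    (fun k₁ k₂ hr₁ hr₂ => mul_gap_le_mul_sub_chemPot_of_equilibria_hotAnchors_threshold_ttPrime t t' hU hβ k₁ hΓ₁ k₂ hΓ₂ hn₁0 hn₂2 hr₁ hn
      hr₂ ha hb hab hcap hf₁ hf₂ hβh₁ hβh₂ h0₁ h0₂ hβ₀ hπ₁ hπ₂ hgM hN)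
    hT₁ hT₂ hω₁ hω₂ hn₁ hn₂

/-! ## §4 THE PERIODIC STATE-LEVEL DICTIONARY (`t–t'`, `T > 0`): when is a stripe a grand-canonical equilibrium state? -/

/-- **A `q`-periodic state with interior cell filling is a `q`-periodic grand-canonical equilibrium state of `H − μN` IFF it attains the canonical
pressure at its cell filling, `s̄(ω) − β ē_q(Φ)(ω) = p(β; ρ̄(ω))`, AND `μ` supports `p(β;·)` at `ρ̄(ω)`** (`Γ` translation covariant with `e_Γ = e_Φ − μρ`,
`β > 0`, `U ≥ 0`). ⇒ through the cell average (same mean entropy, `e_Φ(ω̄) = ē_q(Φ)(ω)`, `ρ(ω̄) = ρ̄(ω)`) and the translation-invariant dictionary;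
⇐ because `P_q(β,Γ) = P(β,Γ) = P(β;μ)`. [cite: Israel1979, Thm. I.2.4] [cite: ArakiMoriya2003, Theorem 12.11] [cite: BratteliRobinsonI1987, §4.3.1] -/
theorem isPerVarEquilibrium_iff_sub_mul_eq_pressureTT'_and_supporting (hω : ω.IsPeriodic q) (hT : Γ.IsTranslationInvariant)
    (hΓ : ∀ σ : InfVolFermionState 2, σ.meanEnergy Γ R' = σ.meanEnergy (hubbardTTPrimeFermionInteraction t t' U) 1 - μ * σ.density)
    (hρ0 : 0 < ω.cellFilling q) (hρ2 : ω.cellFilling q < 2) :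
    ω.IsPerVarEquilibrium β q Γ R' ↔
      ω.entropyDensitySup - β * cellMeanEnergy q (hubbardTTPrimeFermionInteraction t t' U) ω 1 =
          pressureTT' β t t' U (ω.cellFilling q) ∧
        pressureTT' β t t' U (ω.cellFilling q) = gcPressureTT' β t t' U μ - β * μ * ω.cellFilling q := by
  have hΦ := hubbardTTPrimeFermionInteraction_isTranslationInvariant t t' U
  have eΦ : cellMeanEnergy q (hubbardTTPrimeFermionInteraction t t' U) ω 1 =
      (ω.cellAverage q).meanEnergy (hubbardTTPrimeFermionInteraction t t' U) 1 :=
    cellMeanEnergy_eq_meanEnergy_cellAverage hΦ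
  have eρ : ω.cellFilling q = (ω.cellAverage q).density := cellFilling_eq_density_cellAverage ω
  constructor
  · intro h
    have hbar := h.cellAverage_isVarEquilibrium two_pos hT
    have hs := h.entropyDensitySup_cellAverage_eq two_pos hT
    rw [eρ] at hρ0 hρ2
    rw [eΦ, eρ, ← hs]
    exact (isVarEquilibrium_iff_sub_mul_eq_pressureTT'_and_supporting t t' hU hβ hbar.1 hΓ hρ0 hρ2).1 hbar
  · rintro ⟨hs, hμ⟩
    refine ⟨hω, ?_⟩
    rw [FermionInteraction.perVarPressure_eq_varPressure two_pos β q hT R', varPressure_eq_gcPressureTT'_of_muShift t t' hU hβ hΓ,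
      cellMeanEnergy_eq_meanEnergy_cellAverage hT, hΓ, ← eΦ, ← eρ]
    have e : β * (cellMeanEnergy q (hubbardTTPrimeFermionInteraction t t' U) ω 1 - μ * ω.cellFilling q) =
        β * cellMeanEnergy q (hubbardTTPrimeFermionInteraction t t' U) ω 1 - β * μ * ω.cellFilling q := by ring
    rw [e]
    linarith

/-- **A periodic grand-canonical equilibrium state attains the canonical pressure at its cell filling** (`0 < ρ̄ < 2`).
[cite: Israel1979, Thm. I.2.4] [cite: ArakiMoriya2003, Theorem 12.11] -/
theorem IsPerVarEquilibrium.entropyDensitySup_sub_mul_cellMeanEnergy_eq_pressureTT' (hT : Γ.IsTranslationInvariant)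
    (hω : ω.IsPerVarEquilibrium β q Γ R')
    (hΓ : ∀ σ : InfVolFermionState 2, σ.meanEnergy Γ R' = σ.meanEnergy (hubbardTTPrimeFermionInteraction t t' U) 1 - μ * σ.density)
    (hρ0 : 0 < ω.cellFilling q) (hρ2 : ω.cellFilling q < 2) :
    ω.entropyDensitySup - β * cellMeanEnergy q (hubbardTTPrimeFermionInteraction t t' U) ω 1 = pressureTT' β t t' U (ω.cellFilling q) :=
  ((isPerVarEquilibrium_iff_sub_mul_eq_pressureTT'_and_supporting t t' hU hβ hω.1 hT hΓ hρ0 hρ2).1 hω).1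

/-- **… and its chemical potential supports `p(β;·)` at the cell filling**: `p(β; ρ̄(ω)) = P(β; μ) − βμρ̄(ω)`. [cite: Israel1979, Thm. I.2.4] [cite: Ruelle1969, §3.4] -/
theorem IsPerVarEquilibrium.pressureTT'_eq_gcPressureTT'_sub_cellFilling (hT : Γ.IsTranslationInvariant)
    (hω : ω.IsPerVarEquilibrium β q Γ R')
    (hΓ : ∀ σ : InfVolFermionState 2, σ.meanEnergy Γ R' = σ.meanEnergy (hubbardTTPrimeFermionInteraction t t' U) 1 - μ * σ.density)
    (hρ0 : 0 < ω.cellFilling q) (hρ2 : ω.cellFilling q < 2) :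
    pressureTT' β t t' U (ω.cellFilling q) = gcPressureTT' β t t' U μ - β * μ * ω.cellFilling q :=
  ((isPerVarEquilibrium_iff_sub_mul_eq_pressureTT'_and_supporting t t' hU hβ hω.1 hT hΓ hρ0 hρ2).1 hω).2

variable {Γ' : FermionInteraction 2} {R'' μ' : ℝ}

/-- **The chemical potentials carrying a given periodic (stripe) equilibrium state are EXACTLY the supporting set of its cell filling** — the compact
interval `M_β(ρ̄(ω))` of `HubbardTTPrimeGrandCanonicalEquilibriumStateDictionary`. [cite: Israel1979, Thm. I.2.4] [cite: Rockafellar1970, Thm. 24.1] -/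
theorem IsPerVarEquilibrium.isPerVarEquilibrium_iff_supporting (hT : Γ.IsTranslationInvariant) (hT' : Γ'.IsTranslationInvariant)
    (hω : ω.IsPerVarEquilibrium β q Γ R')
    (hΓ : ∀ σ : InfVolFermionState 2, σ.meanEnergy Γ R' = σ.meanEnergy (hubbardTTPrimeFermionInteraction t t' U) 1 - μ * σ.density)
    (hΓ' : ∀ σ : InfVolFermionState 2, σ.meanEnergy Γ' R'' = σ.meanEnergy (hubbardTTPrimeFermionInteraction t t' U) 1 - μ' * σ.density)
    (hρ0 : 0 < ω.cellFilling q) (hρ2 : ω.cellFilling q < 2) :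
    ω.IsPerVarEquilibrium β q Γ' R'' ↔ pressureTT' β t t' U (ω.cellFilling q) = gcPressureTT' β t t' U μ' - β * μ' * ω.cellFilling q := by
  have hs := hω.entropyDensitySup_sub_mul_cellMeanEnergy_eq_pressureTT' t t' hU hβ hT hΓ hρ0 hρ2
  rw [isPerVarEquilibrium_iff_sub_mul_eq_pressureTT'_and_supporting t t' hU hβ hω.1 hT' hΓ' hρ0 hρ2]
  exact ⟨fun h => h.2, fun h => ⟨hs, h⟩⟩

/-- **The grand-canonical interaction instance**: a `q`-periodic `ω` with `0 < ρ̄(ω) < 2` is a `q`-periodic equilibrium state of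
`gcInteractionTT' t t' U μ 0` at `β` iff `s̄(ω) − βē_q(Φ)(ω) = p(β; ρ̄(ω))` and `μ` supports `p(β;·)` at `ρ̄(ω)`. [cite: ArakiMoriya2003, Theorem 12.11] [cite: Ruelle1969, §3.4] -/
theorem isPerVarEquilibrium_gcInteractionTT'_iff (hω : ω.IsPeriodic q) (hρ0 : 0 < ω.cellFilling q) (hρ2 : ω.cellFilling q < 2) :
    ω.IsPerVarEquilibrium β q (gcInteractionTT' t t' U μ 0) 1 ↔
      ω.entropyDensitySup - β * cellMeanEnergy q (hubbardTTPrimeFermionInteraction t t' U) ω 1 =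
          pressureTT' β t t' U (ω.cellFilling q) ∧
        pressureTT' β t t' U (ω.cellFilling q) = gcPressureTT' β t t' U μ - β * μ * ω.cellFilling q :=
  isPerVarEquilibrium_iff_sub_mul_eq_pressureTT'_and_supporting t t' hU hβ hω (gcInteractionTT'_isTranslationInvariant t t' U μ 0)
    (meanEnergy_gcInteractionTT'_zero_field_eq_sub t t' U μ) hρ0 hρ2

end TTPrime

end InfVolFermionState

end Literature.MathematicalPhysics.QuantumLattice

end
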